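import Summits.BirchSwinnertonDyer.BirchSwinnertonDyer.Theorems.ManinLocalTwoThreeShimuraQuotientRational
import Summits.BirchSwinnertonDyer.BirchSwinnertonDyer.Theorems.ManinLocalTwoThreeStevensEqualsOptimal
import HarnessLib

/-!
# The Shimura-cover DICHOTOMY on Stevens' curve: `Λ₁(f) = Λ₀(f)`, or `W₁(ℚ)` has a point of prime order `p ∣ [Λ₀:Λ₁]`
# (modulo the printed cusp-rationality fact); at `9 ∣ N`: `W₀ ≅ W₁` and `|c₀| = |c₁|` unless Stevens' curve has a rational `3`-point

Summit `BirchSwinnertonDyer`, route `ManinLocalTwoThree` (cell bsd-f2-manin), cruxes C3 `ManinPrimeToThreeAtNine`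
(stmt-BirchSwinnertonDyer-22968) and C2 `ManinOddAtFour` (stmt-…-22967); prover seat bsd-line-manin23-p1 (C2/C3 LEAD), gen 10.
Sequel to `…ShimuraQuotientRational.lean` (F★ = `optimalGamma1Parametrization_cusp_rational` ⟹ `Λ₀(f)/Λ₁(f) ↪ W₁(ℚ)_tors`) and
`…StevensEqualsOptimal.lean` (`Λ₁(f) = Λ₀(f)` ⟹ `W₀ = C • W₁`, `u = ±1`).

* §1 `periodLatticeGamma1_eq_periodLattice_of_forall_shimuraIndexPrimeTo` — pure lattice algebra (no F★): if `Λ₀(f)/Λ₁(f)` has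
  no element of prime order for ANY prime, then `Λ₁(f) = Λ₀(f)` (the quotient is killed by `φ(N)`,
  `totient_mul_mem_periodLatticeGamma1`; descending induction on the exponent).
* §2 `periodLatticeGamma1_eq_periodLattice_or_exists_addOrderOf_prime` — F★-DICHOTOMY at ANY level: for an optimal
  `X₁(N)`-datum `D` of `W` (Stevens' curve), `Λ₁(f) = Λ₀(f)` OR `W(ℚ)` has a point of some prime order `p` with
  `p ∣ [Λ₀:Λ₁]`; so **a Stevens curve without rational points of prime order is the strong Weil curve**
  (`periodLatticeGamma1_eq_periodLattice_of_forall_addOrderOf_ne`).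
* §3 `…_or_exists_addOrderOf_eq_of_sq_dvd` — at a traceless prime `p² ∣ N` (`pΛ₀ ⊆ Λ₁`, Ling–Oesterlé): `Λ₁(f) = Λ₀(f)` OR
  `W(ℚ)` has a point of order exactly `p`; at `9 ∣ N`: a rational `3`-point on Stevens' curve, at `4 ∣ N`: a rational `2`-point.
  The hypothesis «no rational `3`-point on `W₁`» is WEAKER than the gen-9 hypothesis «`W[3]` irreducible» (`…OfIrreducible.lean`):
  the reducible-without-rational-point classes (a `3`-isogeny, no `ℚ`-point of order `3` on Stevens' curve) are now covered.
* §4 consequences for the optimal pair `(D₁, D₀)` of a class (isogenous globally minimal `W₁ ~ W₀`, `D₀` lattice-optimal):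
  `|c₀| = |c₁|` and `W₀ = C • W₁` with `u = ±1`, `r, s, t ∈ ℤ` — Stevens' curve IS the strong Weil curve — unless `W₁(ℚ)` has
  a point of order `p` (`p² ∣ N`); headline instances `…_of_nine_dvd_of_forall_addOrderOf_ne_three` (C3 regime) and the
  any-level torsion-free form.

HONEST FRAMING: conditional on the named fact F★ (Conrad–Edixhoven–Stein 2003 §6.1.2/§6.2, statement-only, p673905); no crux
stub is narrowed (the C3 residual `NoRationalThreeTorsionCoprimeIsolatedResidual` hypothesises no `3`-torsion on `W₀`, not on
Stevens' `W₁`); C2, C3, Manin's conjecture and BSD are NOT proved by this file.  No definitions, no sorry.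
-/

set_option autoImplicit false
set_option linter.dupNamespace false

noncomputable section

open scoped Classical MatrixGroups ModularForm

open CongruenceSubgroup Complex WeierstrassCurve Literature.NumberTheory.EllipticCurves
  Literature.NumberTheory.EllipticCurves.ModularForms
open Summit.BirchSwinnertonDyer.Rank1Residual.ManinAdditive.KatoCurve

namespace Summit.BirchSwinnertonDyer.BirchSwinnertonDyer.Theorems.ManinLocalTwoThree

/-! ### §1. Lattice algebra: no element of prime order ⟹ trivial Shimura quotient -/

section Lattice

variable {N : ℕ} [NeZero N] (f : CuspForm (Gamma0 N) 2)

/-- **If `Λ₀(f)/Λ₁(f)` has no element of prime order `p` for every prime `p` (`ShimuraIndexPrimeTo p f` for all `p`), then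
`Λ₁(f) = Λ₀(f)`.**  The quotient is killed by `φ(N)` (`totient_mul_mem_periodLatticeGamma1`); if `n·x ∈ Λ₁` with `n > 1`,
pick a prime `p ∣ n`: `p·((n/p)·x) ∈ Λ₁` forces `(n/p)·x ∈ Λ₁`, and descend. [cite: LingOesterle1991, §1 and Thm. 1] -/
theorem periodLatticeGamma1_eq_periodLattice_of_forall_shimuraIndexPrimeTo
    (h : ∀ p : ℕ, p.Prime → ShimuraIndexPrimeTo p f) : periodLatticeGamma1 f = periodLattice f := by
  refine le_antisymm (periodLatticeGamma1_le_periodLattice f) fun x hx ↦ ?_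
  have key : ∀ n : ℕ, 0 < n → ∀ y ∈ periodLattice f,
      (n : ℂ) * y ∈ periodLatticeGamma1 f → y ∈ periodLatticeGamma1 f := by
    intro n
    induction n using Nat.strong_induction_on with
    | _ n ih =>
      intro hn y hy hny
      by_cases h1 : n = 1
      · subst h1
        simpa using hny
      · obtain ⟨p, hp, m, rfl⟩ := Nat.exists_prime_and_dvd h1
        have hm : 0 < m := Nat.pos_of_mul_pos_left hn
        have hmy : (m : ℂ) * y ∈ periodLattice f := by
          rw [← nsmul_eq_mul]
          exact (periodLattice f).nsmul_mem hy m
        have hpm : (p : ℂ) * ((m : ℂ) * y) ∈ periodLatticeGamma1 f := by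
          rw [← mul_assoc]
          exact_mod_cast hny
        have hmy₁ : (m : ℂ) * y ∈ periodLatticeGamma1 f := h p hp _ hmy hpm
        exact ih m (lt_mul_of_one_lt_left hm hp.one_lt) hm y hy hmy₁
  exact key (Nat.totient N) (Nat.totient_pos.mpr (NeZero.pos N)) x hx (totient_mul_mem_periodLatticeGamma1 f hx)

/-- At a traceless prime (`a_p(f) = 0`, `p ∣ N`: `pΛ₀(f) ⊆ Λ₁(f)`, Ling–Oesterlé) the single condition `ShimuraIndexPrimeTo p f`
already gives `Λ₁(f) = Λ₀(f)`. [cite: LingOesterle1991, Thm. 6 (p. 176)] [cite: AtkinLehner1970, Thm. 3] -/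
theorem periodLatticeGamma1_eq_periodLattice_of_shimuraIndexPrimeTo_of_sq_dvd (hf : IsNewform0 f) {p : ℕ} (hp : p.Prime)
    (hpN : p ^ 2 ∣ N) (hS : ShimuraIndexPrimeTo p f) : periodLatticeGamma1 f = periodLattice f := by
  refine le_antisymm (periodLatticeGamma1_le_periodLattice f) fun z hz ↦ hS z hz ?_
  exact pMulLatticeLeGamma1OfTracelessPrime_holds N f hf p hp ((dvd_pow_self p two_ne_zero).trans hpN)
    (hf.cuspCoeff_eq_zero_of_sq_dvd hp hpN) z hz

end Lattice

/-! ### §2. The dichotomy on Stevens' curve (any level) -/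

section Stevens

variable {W : WeierstrassCurve ℚ} [W.IsElliptic] {N : ℕ} [NeZero N]

/-- **F★-dichotomy, any level**: for an OPTIMAL `X₁(N)`-datum `D` of `W` (Stevens' curve of its class), either the Shimura
cover is trivial, `Λ₁(f) = Λ₀(f)`, or `W(ℚ)` has a point of some PRIME order `p` with `p ∣ [Λ₀(f) : Λ₁(f)]`
(`¬ ShimuraIndexPrimeTo p f`). [cite: ConradEdixhovenStein2003, §6.1.2 and §6.2] [cite: Stevens1989, §2] -/
theorem periodLatticeGamma1_eq_periodLattice_or_exists_addOrderOf_prime (hF : optimalGamma1Parametrization_cusp_rational)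
    (D : Gamma1ParametrizationData W N) (hD : D.IsOptimal) :
    periodLatticeGamma1 D.f = periodLattice D.f ∨
      ∃ (p : ℕ) (P : (W.baseChange ℚ).toAffine.Point), p.Prime ∧ addOrderOf P = p ∧ ¬ ShimuraIndexPrimeTo p D.f := by
  by_cases h : ∀ p : ℕ, p.Prime → ShimuraIndexPrimeTo p D.f
  · exact Or.inl (periodLatticeGamma1_eq_periodLattice_of_forall_shimuraIndexPrimeTo D.f h)
  · push Not at h
    obtain ⟨p, hp, hS⟩ := h
    obtain ⟨P, hP⟩ := exists_point_addOrderOf_eq_of_not_shimuraIndexPrimeTo hF D hD hp hS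
    exact Or.inr ⟨p, P, hp, hP, hS⟩

/-- **A Stevens curve without rational points of prime order is the strong Weil curve of its newform** (F★-conditional):
if `W(ℚ)` has no point of prime order (e.g. `W(ℚ)_tors = 0`), then `Λ₁(f) = Λ₀(f)`.
[cite: ConradEdixhovenStein2003, §6.1.2 and §6.2] [cite: Stevens1989, §2] -/
theorem periodLatticeGamma1_eq_periodLattice_of_forall_addOrderOf_ne (hF : optimalGamma1Parametrization_cusp_rational)
    (D : Gamma1ParametrizationData W N) (hD : D.IsOptimal)
    (htf : ∀ (p : ℕ), p.Prime → ∀ P : (W.baseChange ℚ).toAffine.Point, addOrderOf P ≠ p) :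
    periodLatticeGamma1 D.f = periodLattice D.f := by
  rcases periodLatticeGamma1_eq_periodLattice_or_exists_addOrderOf_prime hF D hD with h | ⟨p, P, hp, hP, -⟩
  · exact h
  · exact absurd hP (htf p hp P)

/-! ### §3. At a traceless prime `p² ∣ N`: trivial cover, or a rational point of order `p` on Stevens' curve -/

/-- **`p² ∣ N`: `Λ₁(f) = Λ₀(f)`, or Stevens' curve has a rational point of order `p`** (F★-conditional; `pΛ₀ ⊆ Λ₁` at the
traceless prime, so `p` is the only possible prime in the index). [cite: LingOesterle1991, Thm. 6 (p. 176)]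
[cite: ConradEdixhovenStein2003, §6.1.2 and §6.2] -/
theorem periodLatticeGamma1_eq_periodLattice_or_exists_addOrderOf_eq_of_sq_dvd
    (hF : optimalGamma1Parametrization_cusp_rational) (D : Gamma1ParametrizationData W N) (hD : D.IsOptimal)
    {p : ℕ} (hp : p.Prime) (hpN : p ^ 2 ∣ N) :
    periodLatticeGamma1 D.f = periodLattice D.f ∨ ∃ P : (W.baseChange ℚ).toAffine.Point, addOrderOf P = p := by
  by_cases hS : ShimuraIndexPrimeTo p D.f
  · exact Or.inl (periodLatticeGamma1_eq_periodLattice_of_shimuraIndexPrimeTo_of_sq_dvd D.f D.isNewformOf.1 hp hpN hS)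
  · exact Or.inr (exists_point_addOrderOf_eq_of_not_shimuraIndexPrimeTo hF D hD hp hS)

/-- `9 ∣ N`: `Λ₁(f) = Λ₀(f)`, or Stevens' curve has a RATIONAL POINT OF ORDER `3` (weaker alternative than «`Ψ₃` has a rational
root», i.e. than reducibility of `W[3]`). [cite: ConradEdixhovenStein2003, §6.1.2 and §6.2] -/
theorem periodLatticeGamma1_eq_periodLattice_or_exists_addOrderOf_eq_three_of_nine_dvd
    (hF : optimalGamma1Parametrization_cusp_rational) (D : Gamma1ParametrizationData W N) (hD : D.IsOptimal)
    (h9 : 3 ^ 2 ∣ N) :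
    periodLatticeGamma1 D.f = periodLattice D.f ∨ ∃ P : (W.baseChange ℚ).toAffine.Point, addOrderOf P = 3 :=
  periodLatticeGamma1_eq_periodLattice_or_exists_addOrderOf_eq_of_sq_dvd hF D hD Nat.prime_three h9

/-- `4 ∣ N`: `Λ₁(f) = Λ₀(f)`, or Stevens' curve has a rational point of order `2` (for `p = 2` this is the gen-9 statement,
since a rational `2`-point is the same as reducible `W[2]`; recorded for symmetry). [cite: ConradEdixhovenStein2003, §6.1.2 and §6.2] -/
theorem periodLatticeGamma1_eq_periodLattice_or_exists_addOrderOf_eq_two_of_four_dvd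
    (hF : optimalGamma1Parametrization_cusp_rational) (D : Gamma1ParametrizationData W N) (hD : D.IsOptimal)
    (h4 : 2 ^ 2 ∣ N) :
    periodLatticeGamma1 D.f = periodLattice D.f ∨ ∃ P : (W.baseChange ℚ).toAffine.Point, addOrderOf P = 2 :=
  periodLatticeGamma1_eq_periodLattice_or_exists_addOrderOf_eq_of_sq_dvd hF D hD Nat.prime_two h4

end Stevens

/-! ### §4. Consequences for the optimal pair of a class: `|c₀| = |c₁|` and `W₀ ≅ W₁`, or a rational `p`-point on `W₁` -/

section Pair

variable {W₁ W₀ : WeierstrassCurve ℚ} [W₁.IsElliptic] [W₁.IsGloballyMinimal] [W₀.IsElliptic]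
  [W₀.IsGloballyMinimal] {N : ℕ} [NeZero N]

/-- **`p² ∣ N`: `|c₀| = |c₁|`, or Stevens' curve has a rational point of order `p`.**  For isogenous globally minimal
`W₁ ~ W₀`, an OPTIMAL `X₁(N)`-datum `D₁` of `W₁` and a lattice-optimal `X₀(N)`-datum `D₀` of `W₀` (F★-conditional; the homothety
engine `natAbs_maninConstant₀_eq_of_periodLatticeGamma1_eq_periodLattice` in the first case).
[cite: ConradEdixhovenStein2003, §6.1.2 and §6.2] [cite: CesnaviciusNeururerSaha2023, Lemma 6.5 (shape)] -/
theorem natAbs_maninConstant₀_eq_or_exists_addOrderOf_eq_of_sq_dvd (hF : optimalGamma1Parametrization_cusp_rational)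
    (D₁ : Gamma1ParametrizationData W₁ N) (D₀ : ModularParametrizationData W₀ N) (hiso : IsIsogenous W₁ W₀)
    (h₁ : D₁.IsOptimal) (h₀ : ∀ z ∈ D₀.L.lattice, ∃ w ∈ periodLattice D₀.f, z = D₀.c * w)
    {p : ℕ} (hp : p.Prime) (hpN : p ^ 2 ∣ N) :
    D₀.maninConstant.natAbs = D₁.maninConstant.natAbs ∨
      ∃ P : (W₁.baseChange ℚ).toAffine.Point, addOrderOf P = p := by
  rcases periodLatticeGamma1_eq_periodLattice_or_exists_addOrderOf_eq_of_sq_dvd hF D₁ h₁ hp hpN with h | h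
  · left
    have hf : D₁.f = D₀.f := D₁.f_eq_of_isIsogenous D₀ hiso
    exact natAbs_maninConstant₀_eq_of_periodLatticeGamma1_eq_periodLattice D₁ D₀ h₁ h₀ hf (hf ▸ h)
  · exact Or.inr h

/-- **`p² ∣ N`: Stevens' curve IS the strong Weil curve (`W₀ = C • W₁`, `u = ±1`, `r, s, t ∈ ℤ`), or it has a rational point
of order `p`** (F★-conditional; `exists_variableChange_eq_of_periodLatticeGamma1_eq` in the first case).
[cite: ConradEdixhovenStein2003, §6.1.2 and §6.2] [cite: Stevens1989, §2] -/
theorem exists_variableChange_eq_or_exists_addOrderOf_eq_of_sq_dvd (hF : optimalGamma1Parametrization_cusp_rational)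
    (D₁ : Gamma1ParametrizationData W₁ N) (D₀ : ModularParametrizationData W₀ N) (hiso : IsIsogenous W₁ W₀)
    (h₁ : D₁.IsOptimal) (h₀ : ∀ z ∈ D₀.L.lattice, ∃ w ∈ periodLattice D₀.f, z = D₀.c * w)
    {p : ℕ} (hp : p.Prime) (hpN : p ^ 2 ∣ N) :
    (∃ C : VariableChange ℚ, C • W₁ = W₀ ∧ (C.u = 1 ∨ C.u = -1) ∧ ∃ r s t : ℤ, C.r = r ∧ C.s = s ∧ C.t = t) ∨
      ∃ P : (W₁.baseChange ℚ).toAffine.Point, addOrderOf P = p := by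
  rcases periodLatticeGamma1_eq_periodLattice_or_exists_addOrderOf_eq_of_sq_dvd hF D₁ h₁ hp hpN with h | h
  · left
    have hf : D₁.f = D₀.f := D₁.f_eq_of_isIsogenous D₀ hiso
    exact exists_variableChange_eq_of_periodLatticeGamma1_eq D₁ D₀ hiso h₁ h₀ (hf ▸ h)
  · exact Or.inr h

/-- **C3 regime, headline**: at `9 ∣ N`, if Stevens' curve `W₁` has NO rational point of order `3`, then `|c₀| = |c₁|` AND
`W₀ = C • W₁` with `u = ±1` (F★-conditional).  Compare gen 9's `…_of_nine_dvd_of_forall_not_isRoot_Ψ₃` (hypothesis: `Ψ₃(W₀)`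
without rational root, i.e. `W[3]` irreducible — strictly stronger). [cite: ConradEdixhovenStein2003, §6.1.2 and §6.2] -/
theorem natAbs_eq_and_exists_variableChange_of_nine_dvd_of_forall_addOrderOf_ne_three
    (hF : optimalGamma1Parametrization_cusp_rational)
    (D₁ : Gamma1ParametrizationData W₁ N) (D₀ : ModularParametrizationData W₀ N) (hiso : IsIsogenous W₁ W₀)
    (h₁ : D₁.IsOptimal) (h₀ : ∀ z ∈ D₀.L.lattice, ∃ w ∈ periodLattice D₀.f, z = D₀.c * w) (h9 : 3 ^ 2 ∣ N)
    (hT : ∀ P : (W₁.baseChange ℚ).toAffine.Point, addOrderOf P ≠ 3) :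
    D₀.maninConstant.natAbs = D₁.maninConstant.natAbs ∧
      ∃ C : VariableChange ℚ, C • W₁ = W₀ ∧ (C.u = 1 ∨ C.u = -1) ∧ ∃ r s t : ℤ, C.r = r ∧ C.s = s ∧ C.t = t := by
  refine ⟨?_, ?_⟩
  · rcases natAbs_maninConstant₀_eq_or_exists_addOrderOf_eq_of_sq_dvd hF D₁ D₀ hiso h₁ h₀ Nat.prime_three h9
      with h | ⟨P, hP⟩
    · exact h
    · exact absurd hP (hT P)
  · rcases exists_variableChange_eq_or_exists_addOrderOf_eq_of_sq_dvd hF D₁ D₀ hiso h₁ h₀ Nat.prime_three h9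
      with h | ⟨P, hP⟩
    · exact h
    · exact absurd hP (hT P)

/-- **Any level, torsion-free form**: if Stevens' curve `W₁` has no rational point of prime order (e.g. `W₁(ℚ)_tors = 0`), then
`|c₀| = |c₁|` and `W₀ = C • W₁` with `u = ±1` for the lattice-optimal `X₀(N)`-datum of any isogenous globally minimal `W₀`
(F★-conditional). [cite: ConradEdixhovenStein2003, §6.1.2 and §6.2] [cite: Stevens1989, §2] -/
theorem natAbs_eq_and_exists_variableChange_of_forall_addOrderOf_ne (hF : optimalGamma1Parametrization_cusp_rational)
    (D₁ : Gamma1ParametrizationData W₁ N) (D₀ : ModularParametrizationData W₀ N) (hiso : IsIsogenous W₁ W₀)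
    (h₁ : D₁.IsOptimal) (h₀ : ∀ z ∈ D₀.L.lattice, ∃ w ∈ periodLattice D₀.f, z = D₀.c * w)
    (htf : ∀ (p : ℕ), p.Prime → ∀ P : (W₁.baseChange ℚ).toAffine.Point, addOrderOf P ≠ p) :
    D₀.maninConstant.natAbs = D₁.maninConstant.natAbs ∧
      ∃ C : VariableChange ℚ, C • W₁ = W₀ ∧ (C.u = 1 ∨ C.u = -1) ∧ ∃ r s t : ℤ, C.r = r ∧ C.s = s ∧ C.t = t := by
  have h := periodLatticeGamma1_eq_periodLattice_of_forall_addOrderOf_ne hF D₁ h₁ htf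
  have hf : D₁.f = D₀.f := D₁.f_eq_of_isIsogenous D₀ hiso
  exact ⟨natAbs_maninConstant₀_eq_of_periodLatticeGamma1_eq_periodLattice D₁ D₀ h₁ h₀ hf (hf ▸ h),
    exists_variableChange_eq_of_periodLatticeGamma1_eq D₁ D₀ hiso h₁ h₀ (hf ▸ h)⟩

end Pair

end Summit.BirchSwinnertonDyer.BirchSwinnertonDyer.Theorems.ManinLocalTwoThree

end
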